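/-
Copyright (c) 2026 the pub-hodgecm-mathlib formalisation cell (harness21).  Prover seat hodgecm-mathlib-R90-C14-p04 (g0) (free R90-TF hand routed to L1 by
CHAIR VALVE WORD W4), Track B «K2-LIT» ∕ hLiu418 #184♮, Road I v3, unit U5 «THE CLOSE»: FACE-D₀ row `h2₂` «line lifts have rank ≤ 1» — brick (B1-fin), parts
(B1a)(B1b) of the census (R90∕K2 bus 23:35:58Z; LEAD F0P6-plan (g14) BATCH #151 (1)).  THEOREMS ONLY.  2026-09-04.
-/
import Summits.HodgeConjecture.HodgeConjecture.Theorems.H413ThetaPairRepArchFinFactorisation   -- ★ `pairRep_one_finAdelicToAdelic_tmul` (second member), brings ★ `WeilCoinv.pairRep_finPairToAdelic_piSBReindex_tmul`, ★ `piSBReindex_tmul`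
import Summits.HodgeConjecture.HodgeConjecture.Theorems.K2LiuFirstTermLineLiftRankRowModel    -- ★ p863026 (this seat, B5-fin): the consumer of the letter `hI`; brings ★ `toDiagA`, the #42F′ line-pair carriers
import HarnessLib

/-!
# K2_Liu road (hLiu418 = stmt-HodgeConjecture-24832), Road I v3, U5 «THE CLOSE», FACE-D₀ row `h2₂`, brick (B1-fin) parts (B1a)(B1b):
# THE FINITE WEIL LETTER — `ω(toDiagA (ι z), 1)(Φ_∞ ⊗ φ) = Φ_∞ ⊗ ρ_f(z) φ` for FINITE-adelic elements of the FIRST member of the small pair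

Cell `pub/hodgecm-mathlib` (D-0151), Track B, build stream 29; helper lane `--supports stmt-HodgeConjecture-24832 --as helper`, count-neutral.
★ p863026 `K2LiuFirstTermLineLiftRankRowModel.fourierCoeffDelta_thetaLift_eq_zero_of_finLineModel` pays the letter `hΛ` of ★ p862821 §2 (row `h2₂`) from ★ U2a on
the finite-adelic factor, HYPOTHESIS-FIRST on the Weil letter
`hI : ∀ z Φ_∞ φ, ω(toDiagA (ι z), 1)(piSchwartzBruhatEquiv (Φ_∞ ⊗ φ)) = piSchwartzBruhatEquiv (Φ_∞ ⊗ ρf z φ)` (census (B1-fin)).  THIS FILE discharges `hI` BY NAME for the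
FIRST member of the small dual pair `U(𝔻) × U(⟨a′⟩)` at FINITE-adelic points — the finite twin of K2Liu-p09's ARCH pinning ★ `K2LiuFaceGThetaLetter.pairRep_toDiagA_archExp_tmul`
([Weil1964, Chap. III n° 37–38: `𝐫_𝐀 = ⊗_v 𝐫_v` — a finite-adelic group element acts on a pure tensor `Φ_∞ ⊗ Φ_f` inside the finite slot]):

* §1 **`pairRep_finAdelicToAdelic_one_tmul`** (GENERIC unitary dual pair `U(J_V) × U(J_W)` over `E∕F`, any compatible splitting `s`): for `k ∈ U(J_V)(𝔸_{F,f})`,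
  `ω_ψ(s_pair((1_∞, k), 1))(Φ_∞ ⊗ Φ_f) = Φ_∞ ⊗ R_e^f (finPairRep hs (k, 1) ((R_e^f)⁻¹ Φ_f))` — the FIRST-member twin of ★ `ThetaNonvanishing.pairRep_one_finAdelicToAdelic_tmul`
  (★ Kronecker-currency factorisation `WeilCoinv.pairRep_finPairToAdelic_piSBReindex_tmul` read in `𝒮(𝔸_Fⁿ)` through `piSBReindex F e = R_e^∞ ⊗ R_e^f`).
* §2 **`pairRep_toDiagA_finAdelic_tmul`** (the #42F′ line pair `(diagonal dD, J_W(a′))`, splitting `s = chiSplittingLine λ`, ★ `isCompatible_chiSplittingLine`): ★ p863026's `hI`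
  for ANY group `Z` mapped into the finite-adelic points of `U(diagonal dD)` (`κ : Z →* U(diag dD)(𝔸_{L⁺,f})`) whose images are the elements `toDiagA (ι z)` (`hκι`) and ANY
  `ρf : Representation ℂ Z 𝒮(𝔸_f^{n″})` that IS the `R_{e₁}^f`-conjugate of `finPairRepV hs ∘ κ` (`hρf`, `rfl` at the wiring — kept as a letter so that this file stays
  THEOREMS ONLY).  With it, ★ p863026's letters reduce to the MODEL letters (ii) for this explicit `ρf` (census (B1c): the finite Schrödinger multiplier formula on
  `N_Δ(𝔸_f)`, `hb`, `hπ`, `hψ`, `hχ∕hχS`) and the bookkeeping `hκι`.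

No definition, no instance, no notation, no named-fact hypothesis, no `sorry`; axioms ⊆ {propext, Classical.choice, Quot.sound}.  HONEST LABEL: HC_CM is proved only modulo
the 7 printed citations (2 remaining named inputs: hLiu418 = stmt-HodgeConjecture-24832, h413 = stmt-HodgeConjecture-24833) until rung 0 closes; this file moves no counter.

References: [Weil1964] A. Weil, Acta Math. 111 (1964) Chap. III n° 37–38 pp. 188–190, n° 41 Thm 6 p. 193; [GelbartRogawski1991] S. Gelbart, J. Rogawski, Invent. Math.
105 (1991) §3.1 Prop. 3.1.1 p. 455; [Liu2021] Y. Liu, Camb. J. Math. 9 (2021) App. D §D.1 Steps 2–3, App. B Prop. B.8 p. 104; [KudlaRallis1994] §3.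
-/

set_option autoImplicit false
set_option linter.dupNamespace false
-- statements over the adelic dual-pair carriers elaborate to very large types; elaborate sequentially (as in ★ p863026)
set_option Elab.async false

noncomputable section

open NumberField NumberField.mixedEmbedding MeasureTheory IsDedekindDomain
open scoped Matrix ComplexOrder ENNReal TensorProduct SchwartzMap Classical  -- `Classical`: the `Fintype` of real ∕ complex places inside `mixedSpace` (as ★ p862586)

namespace Summit.HodgeConjecture.HodgeConjecture.Cruxes.HLiu418.K2LiuFirstTermLineLiftWeilLetterFin

open Literature.NumberTheory.Automorphic Literature.NumberTheory.Automorphic.UnitaryGroup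
open Literature.NumberTheory.Automorphic.IdeleClassGroup
open Literature.NumberTheory.Automorphic.Liu2021
open Literature.NumberTheory.Automorphic.Liu2021.Def411WeilCarriers
open Literature.NumberTheory.Automorphic.Liu2021.Def411WeilCarriersDoubling
open Literature.NumberTheory.GelbartRogawski1991 Literature.NumberTheory.GelbartRogawski1991.UnitaryDualPair
open Literature.NumberTheory.GelbartRogawski1991.GRConstruction
open Literature.NumberTheory.GaloisRepresentations
open Literature.NumberTheory.Weil1964
open Literature.RepresentationTheory Literature.RepresentationTheory.Liu2021
open Literature.NumberTheory.K2Lit.DoubledLineTheta Literature.NumberTheory.K2Lit.SiegelDoubled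
open Summit.HodgeConjecture.HodgeConjecture.Cruxes.H413.ThetaNonvanishing (proj_apply_eq_toSp)

/-! ## §1 Generic: a finite-adelic element of the FIRST member acts inside the finite slot -/

section Generic

variable (F E : Type) [Field F] [NumberField F] [Field E] [NumberField E] [Algebra F E]
variable (c : E ≃ₐ[F] E) (N M : ℕ) {n : ℕ} (e : Fin N × Fin M ≃ Fin n)
variable (JV : Matrix (Fin N) (Fin N) E) (JW : Matrix (Fin M) (Fin M) E)
variable {TV : Matrix (Fin N) (Fin N) F} {TW : Matrix (Fin M) (Fin M) F}
variable [Algebra.IsQuadraticExtension F E] {δ : E} (hcδ : c δ = -δ) (hδ : δ ≠ 0) {d : F}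
  (hd : δ * δ = algebraMap F E d) (hV : TV.IsSymm) (hW : TW.IsSymm) (hVd : IsUnit TV.det) (hWd : IsUnit TW.det)
  (hJV : JV = TV.map (algebraMap F E)) (hJW : JW = TW.map (algebraMap F E))
variable {s : UnitaryGroup.adelicPair F E c N M JV JW →* adelicMpCont F (Fin n) (adelicGram F e TV TW)}
  (hs : (splittingDatum F E c N M e JV JW hcδ hδ hd hV hW hVd hWd hJV hJW).IsCompatible s)

/-- `R_e^∞ (R_{e⁻¹}^∞ Φ) = Φ` on the archimedean Schwartz space. [folklore] -/
private theorem schwartzReindexCLM_symm_apply (Φinf : 𝓢((Fin n → mixedSpace F), ℂ)) :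
    schwartzReindexCLM F e (schwartzReindexCLM F e.symm Φinf) = Φinf := by
  ext w
  rw [schwartzReindexCLM_apply, schwartzReindexCLM_apply]
  congr 1
  funext i
  simp

include hs in
/-- **finite half, FIRST member**: `ω_ψ(s_pair((1_∞, k), 1))(Φ_∞ ⊗ Φ_f) = Φ_∞ ⊗ R_e^f (finPairRep hs (k, 1) ((R_e^f)⁻¹ Φ_f))` for `k ∈ U(J_V)(𝔸_{F,f})` — the twin of
★ `pairRep_one_finAdelicToAdelic_tmul` (★ Kronecker-currency factorisation read in `𝒮(𝔸_Fⁿ)` through `piSBReindex F e = R_e^∞ ⊗ R_e^f`): a finite-adelic group element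
moves a pure tensor inside the FINITE slot. [cite: Weil1964, Chap. III n° 37–38 pp. 188–190] [cite: GelbartRogawski1991, §3.1 Prop. 3.1.1 p. 455] -/
theorem pairRep_finAdelicToAdelic_one_tmul (k : UnitaryGroup.finAdelic F E c N JV) (Φinf : 𝓢((Fin n → mixedSpace F), ℂ))
    (Φfin : FinSB F (Fin n)) :
    pairRep F E c N M e JV JW s (UnitaryGroup.finAdelicToAdelic F E c N JV k, 1) (piSchwartzBruhatEquiv F (Fin n) (Φinf ⊗ₜ Φfin)) =
      piSchwartzBruhatEquiv F (Fin n) (Φinf ⊗ₜ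
        finSBReindex F e (WeilCoinv.finPairRep F E c N M e JV JW hcδ hδ hd hV hW hVd hWd hJV hJW hs (k, 1)
          ((finSBReindex F e).symm Φfin))) := by
  have h1 : ((UnitaryGroup.finAdelicToAdelic F E c N JV k : UnitaryGroup.adelic F E c N JV), (1 : UnitaryGroup.adelic F E c M JW)) =
      WeilCoinv.finPairToAdelic F E c N M JV JW (k, 1) :=
    Prod.ext rfl (by change (1 : UnitaryGroup.adelic F E c M JW) = UnitaryGroup.finAdelicToAdelic F E c M JW 1
                     exact (map_one _).symm)
  have key := WeilCoinv.pairRep_finPairToAdelic_piSBReindex_tmul F E c N M e JV JW hcδ hδ hd hV hW hVd hWd hJV hJW hs (k, 1)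
    (schwartzReindexCLM F e.symm Φinf) ((finSBReindex F e).symm Φfin)
  rw [piSBReindex_tmul, piSBReindex_tmul, schwartzReindexCLM_symm_apply, LinearEquiv.apply_symm_apply] at key
  exact (congrArg (fun p => pairRep F E c N M e JV JW s p (piSchwartzBruhatEquiv F (Fin n) (Φinf ⊗ₜ Φfin))) h1).trans key

end Generic

/-! ## §2 The #42F′ line pair: ★ p863026's letter `hI` by name -/

section LinePair

variable (L : Type) [Field L] [NumberField L] [IsCMField L]
variable {N n : ℕ} (e : Fin N × Fin 1 ≃ Fin n)
  (dV : Fin N → L) (hdV : ∀ i, IsCMField.complexConj L (dV i) = dV i)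
  (dW : Fin 1 → L) (hdW : ∀ i, IsCMField.complexConj L (dW i) = dW i)
  {n'' : ℕ} (e₁ : Fin (n + n) × Fin 1 ≃ Fin n'')
  (hdV0 : ∀ i, dV i ≠ 0) (hdW0 : ∀ i, dW i ≠ 0)
  (lam : IdeleClassGroup L →ₜ* Circle) (hlam : IsConjugateSymplectic L lam) (a' : (Fp L)ˣ)

set_option maxHeartbeats 1000000 in -- the small pair's splitting telescope (as ★ `K2LiuFaceGThetaLetter.pairRep_toDiagA_archExp_tmul`)
/-- **THE FINITE WEIL LETTER `hI` OF ★ p863026 AT THE LINE PAIR** `U(diagonal dD) × U(J_W(a′))`, splitting `s_{λ} = chiSplittingLine …` (★ `isCompatible_chiSplittingLine`):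
for ANY group `Z` with a homomorphism `κ` into the finite-adelic points of `U(diagonal dD)` realising the elements `toDiagA (ι z)` (`hκι`) and ANY representation `ρf` of `Z` on
`𝒮(𝔸_f^{n″})` that is the `R_{e₁}^f`-conjugate of `finPairRepV hs ∘ κ` (`hρf`),
`ω(toDiagA (ι z), 1)(piSchwartzBruhatEquiv (Φ_∞ ⊗ φ)) = piSchwartzBruhatEquiv (Φ_∞ ⊗ ρf z φ)` (§1 at the datum, ★ `finPairRepV_apply`).
[cite: Weil1964, Chap. III n° 37–38 pp. 188–190] [cite: GelbartRogawski1991, §3.1 Prop. 3.1.1 p. 455] [cite: Liu2021, App. D §D.1 Steps 2–3] -/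
theorem pairRep_toDiagA_finAdelic_tmul {Z : Type*} [Group Z]
    (κ : Z →* UnitaryGroup.finAdelic (Fp L) L (IsCMField.complexConj L) (n + n) (Matrix.diagonal (dD L e dV hdV dW hdW)))
    (ι : Z → unipDelta L e dV hdV dW hdW)
    (hκι : ∀ z, toDiagA L e dV hdV dW hdW ((ι z : unipDelta L e dV hdV dW hdW) : HA L e dV hdV dW hdW) =
      UnitaryGroup.finAdelicToAdelic (Fp L) L (IsCMField.complexConj L) (n + n) (Matrix.diagonal (dD L e dV hdV dW hdW)) (κ z))
    (ρf : Representation ℂ Z (FinSB (Fp L) (Fin n'')))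
    (hρf : ∀ (z : Z) (φ : FinSB (Fp L) (Fin n'')),
      ρf z φ = finSBReindex (Fp L) e₁
        (WeilCoinv.finPairRepV (Fp L) L (IsCMField.complexConj L) (n + n) 1 e₁ (Matrix.diagonal (dD L e dV hdV dW hdW)) (JW (Fp L) L a')
          (complexConj_imagUnit L) (imagUnit_ne_zero L) (imagUnit_mul_self L)
          (realDiagonal_isSymm L (dD L e dV hdV dW hdW) (dD_conj L e dV hdV dW hdW)) (isSymm_TW (Fp L) a')
          (isUnit_det_realDiagonal L (dD L e dV hdV dW hdW) (dD_conj L e dV hdV dW hdW) (dD_ne_zero L e dV hdV dW hdW hdV0 hdW0))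
          (isUnit_det_TW (Fp L) a') (realDiagonal_map L (dD L e dV hdV dW hdW) (dD_conj L e dV hdV dW hdW)).symm (JW_eq (Fp L) L a')
          (isCompatible_chiSplittingLine L e₁ (dD L e dV hdV dW hdW) (dD_conj L e dV hdV dW hdW) (dD_ne_zero L e dV hdV dW hdW hdV0 hdW0)
            (toHeckeCharacter L lam) (isUnitary_toHeckeCharacter L lam) ((isOscillatorChar_toHeckeCharacter_iff lam).mpr hlam)
            (TW (Fp L) a') (isSymm_TW (Fp L) a') (isUnit_det_TW (Fp L) a') (JW (Fp L) L a') (JW_eq (Fp L) L a'))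
          (κ z) ((finSBReindex (Fp L) e₁).symm φ)))
    (z : Z) (Φinf : 𝓢((Fin n'' → mixedSpace (Fp L)), ℂ)) (φ : FinSB (Fp L) (Fin n'')) :
    pairRep (Fp L) L (IsCMField.complexConj L) (n + n) 1 e₁ (Matrix.diagonal (dD L e dV hdV dW hdW)) (JW (Fp L) L a')
        (chiSplittingLine L e₁ (dD L e dV hdV dW hdW) (dD_conj L e dV hdV dW hdW) (dD_ne_zero L e dV hdV dW hdW hdV0 hdW0)
          (toHeckeCharacter L lam) (isUnitary_toHeckeCharacter L lam)
          ((isOscillatorChar_toHeckeCharacter_iff lam).mpr hlam) (TW (Fp L) a')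
          (isUnit_det_TW (Fp L) a') (JW (Fp L) L a') (JW_eq (Fp L) L a'))
        (toDiagA L e dV hdV dW hdW ((ι z : unipDelta L e dV hdV dW hdW) : HA L e dV hdV dW hdW), 1)
        (piSchwartzBruhatEquiv (Fp L) (Fin n'') (Φinf ⊗ₜ[ℂ] φ)) =
      piSchwartzBruhatEquiv (Fp L) (Fin n'') (Φinf ⊗ₜ[ℂ] ρf z φ) := by
  rw [hκι, hρf, WeilCoinv.finPairRepV_apply]
  exact pairRep_finAdelicToAdelic_one_tmul (Fp L) L (IsCMField.complexConj L) (n + n) 1 e₁ (Matrix.diagonal (dD L e dV hdV dW hdW)) (JW (Fp L) L a')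
    (complexConj_imagUnit L) (imagUnit_ne_zero L) (imagUnit_mul_self L)
    (realDiagonal_isSymm L (dD L e dV hdV dW hdW) (dD_conj L e dV hdV dW hdW)) (isSymm_TW (Fp L) a')
    (isUnit_det_realDiagonal L (dD L e dV hdV dW hdW) (dD_conj L e dV hdV dW hdW) (dD_ne_zero L e dV hdV dW hdW hdV0 hdW0))
    (isUnit_det_TW (Fp L) a') (realDiagonal_map L (dD L e dV hdV dW hdW) (dD_conj L e dV hdV dW hdW)).symm (JW_eq (Fp L) L a')
    (isCompatible_chiSplittingLine L e₁ (dD L e dV hdV dW hdW) (dD_conj L e dV hdV dW hdW) (dD_ne_zero L e dV hdV dW hdW hdV0 hdW0)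
      (toHeckeCharacter L lam) (isUnitary_toHeckeCharacter L lam) ((isOscillatorChar_toHeckeCharacter_iff lam).mpr hlam)
      (TW (Fp L) a') (isSymm_TW (Fp L) a') (isUnit_det_TW (Fp L) a') (JW (Fp L) L a') (JW_eq (Fp L) L a'))
    (κ z) Φinf φ

end LinePair

end Summit.HodgeConjecture.HodgeConjecture.Cruxes.HLiu418.K2LiuFirstTermLineLiftWeilLetterFin

end
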